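import Mathlib
import HarnessLib
import HarnessLib.Audit
import Summits.AtomisticToContinuum.Statement
import Literature.MathematicalPhysics.QuantumManyBody.PeriodicBoseGas

/-!
Route: BECFeynmanWaist

CLOSED (retired) 2026-08-15T13:38:43Z by operator:999:1257524 — reason: not-a-thesis: assembly does not conclude the sub-problem Statement — note: D-0027 §2.1 audit (human 2026-08-15: routes that do not decide the summit are removed): the assembly concludes `Literature.MathematicalPhysics.QuantumManyBody.BoseGas.BoseEinsteinCondensation`, not the sub-problem statement; a NEW conforming route may be opened from the same idea (generated `closes . The file is kept as the record of this route; refuted decls are indexed as negative knowledge (`ledger negatives`).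

# Route BECFeynmanWaist — Landau's phonon as a vortex-area inequality — Bloch-equivariant Bose maps
sweep p₀-area ≥ c|k|², so sectors cost ≥ 2c|k|²; BEC by the particle–hole moment bound and equal-a
transfer

It suffices to show X = VortexAreaFloor ∧ NearConvexity ∧ BoundaryTransferWeak ∧
ScatteringLengthTransfer (card feynman-node-waist-landau,
spine; the last two conjuncts are the shared tails of routes BECPeriodicReduction/BECSectorGap and
EqualScatteringTransfer). VortexAreaFloor
is the card's conjecture (FW) in its corrected, coarea-free form: on the torus of side L, N bosons
at density in [ρ/2, 2ρ], ρ < ρ₀(v),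
bounded repulsive finite-range v ≢ 0 with positive translation-invariant C¹ ground state Φ (p₀ =
Φ²), every symmetric periodic Bloch-k map
F (k ≠ 0, |k|² ≤ Cρ) with ∫|F|²p₀ = 1 and ∫|∇F|²p₀ ≤ Λ|k|² has total Jacobian mass ∫ J_F p₀ ≥ c|k|²,
J_F = |d Re F ∧ d Im F| — by the
coarea formula exactly "the p₀-weighted area of the whole family of vortex sheets {F = z}, z ∈ ℂ, is
≥ c|k|²". The card's unit-disc waist
was found FALSE at Bogoliubov level while drafting (multi-quantum maps (ρ_q)ⁿ/√(n!), see Cheapest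
falsifier) and is replaced by the total
area, which cannot be gamed by reparametrising values. Pointwise |∇F|² ≥ 2J_F and the ground-state
representation ⟨FΦ,(H−E₀)FΦ⟩ =
∫|∇F|²Φ² give the one-sided sector floor E_M(k) ≥ E₀(M) + min(Λ, 2c)|k|² for M = N ± 1;
NearConvexity (2E₀(N) ≤ E₀(N+1) + E₀(N−1) +
κ(2π/L)²) turns it into BECSectorGap's particle–hole floor restricted to bounded v, whose provable
supports (ZeroMomentumGround,
MomentBoundCondensation, FreeGasCondensation, shared verbatim) give constant-mode condensation on
the torus; BoundaryTransferWeak carries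
torus ⇒ Dirichlet and ScatteringLengthTransfer (+ RepresentativesExist, ScatteringLengthFinite)
carries bounded v ⇒ every admissible w of
equal scattering length (hard cores included). The card's nodal lemma (T) is the provable support
NodalLemma: N ∤ m forces zeros, hence
J_F ≢ 0 for every single admissible map (qualitative positivity of the area), and it is the
topological input of the calibration proof.
Lean: `VortexAreaFloor ∧ NearConvexity ∧ BoundaryTransferWeak ∧ ScatteringLengthTransfer`

## Assembly
Pure logic (proved sorry-free in Sketch.lean as `assembly_holds`, axioms propext / Classical.choice
/ Quot.sound): VortexAreaToPeriodicBEC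
fed with VortexAreaFloor, TorusGroundState, GroundStateRepresentation, NearConvexity and the three
BECSectorGap supports gives the
PeriodicBEC body for every bounded admissible v; BoundaryTransferWeak turns each into small-density
HasGroundStateBEC v; for an arbitrary
admissible w, ScatteringLengthFinite gives a := scatteringLength w ≠ ⊤, RepresentativesExist at
a.toReal gives a bounded admissible v with
scatteringLength v = ofReal a.toReal = a (ENNReal.ofReal_toReal), and ScatteringLengthTransfer v w
closes the conjunct for w. On the way
the route proves RepresentativeBEC of EqualScatteringTransfer (stmt-4286) for EVERY bounded
representative.

Rationale: WHY THIS LINE. Mechanism (card feynman-node-waist-landau; Feynman1954 made topological and metric):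
Bose symmetry plus Bloch equivariance force every
continuous trial map of a momentum sector with N ∤ m to vanish on codimension-2 "vortex sheets" in
configuration space (degree argument,
NodalLemma), and since |∇F|² ≥ 2|J_F| the sector energy is at least twice the p₀-weighted AREA swept
by the map — so Landau's criterion
(CorneanDerezinskiZin2009 Conj. 1.1/2.2, open in the thermodynamic limit) becomes an inf-type
GEOMETRIC statement with dual certificates:
in the Gaussian (Bogoliubov = Feynman single-mode) model of p₀ it is a THEOREM, ∫J_F p₀ ≥
½·v_F·|k|·‖F‖² with v_F = inf_q |q|/S(q) = c_s,
proved by (i) an ℓ¹ Jacobian inequality J_F ≥ Σ_q |det(dF|Π_q)| over Feynman's orthogonal plane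
fields Π_q = span(∇Re ρ_q, ∇Im ρ_q) and
(ii) the momentum–area identity (k·ê)‖F‖² = Σ_q (q·ê)·E[|∂_qF|² − |∂_q̄F|²] (Gaussian integration by
parts of the equivariance generator) —
a calibration of the vortex sheets by Feynman's own foliations, exactly the dual certificate the
card asked for. Imported: geometric measure
theory (coarea, waists of measures Gromov2003/Klartag2017/AkopyanKarasev2020 as the motivating
functional, the Ginzburg–Landau
Jacobian/coarea toolbox JerrardSoner2002 and Sandier–Serfaty doi:10.1016/s0022-1236(03)00199-x for
codimension-2 concentration,
calibrations) and covering-space degree theory; many-body inputs are the ground-state transform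
(ReedSimonIV1978 XIII.47-type positivity),
hyperuniformity S(q) ≤ C|q|ξ for the real-p₀ remainder, and the particle–hole moment bound of
Wagner1966/Stringari1995 filed by
BECSectorGap. Versus existing routes: BECSectorGap WANTS the sector floor (SectorGapFloor, no
mechanism) and this route PRODUCES it for soft
potentials; sector-poincare-two-scale (open card) attacks the same Rayleigh quotient by two-scale
functional inequalities, sharing only the
ground-state transform; no route or negative (index empty) uses nodal geometry, Jacobians or
calibrations.

RANKED CRUXES. #2 VortexAreaFloor (crux) — (card FW, corrected: total vortex area instead of
unit-disc waist) for every bounded repulsive finite-range v with ∫v ≠ 0 and all C, Λ > 0 there are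
c, ρ₀ > 0 such that for 0 < ρ < ρ₀, eventually in L, for every N with N/L³ ∈ [ρ/2, 2ρ], every
positive translation-invariant periodic C¹ ground state Φ of N bosons on the torus of side L (energy
= E₀^per(N,L) < ∞), every k ≠ 0 with |k|² ≤ Cρ and every C¹ periodic symmetric Bloch-k map F with
∫_cell |F|²Φ² = 1 and ∫_cell |∇F|²Φ² ≤ Λ|k|²: c|k|² ≤ ∫_cell J_F Φ² with J_F = ((Σ(Re ∂F)²)(Σ(Im
∂F)²) − (Σ Re ∂F·Im ∂F)²)^(1/2) the 2-Jacobian (area element of dRe F ∧ dIm F). Gaussian level: ≥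
½c_s|k| (linear); Feynman's map and the multi-quantum maps (ρ_q)ⁿ/√(n!) give energy/2; peak-tracking
relays e^(ik·c(X)) give |k|q_s/S(q_s) ≥ c_s|k|; the free gas violates it (eₙ maps: π|k|/L), hence ∫v
≠ 0. [difficulty: open-problem] (why it might fail: Beyond the Gaussian model the momentum–area
identity has a remainder ((𝓛+ε_q)ρ_q ≠ 0: Feynman–Cohen backflow, non-orthogonal planes, UV modes)
that must stay below the main term uniformly in N — as hard as Landau plus S(q) ≤ C|q|ξ down to
2π/L; c decays in C.) [Feynman1954, CorneanDerezinskiZin2009, doi:10.1103/PhysRev.102.1189,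
doi:10.1007/s000390300004, doi:10.1007/s00039-017-0397-8, doi:10.1006/jfan.2001.3906,
doi:10.1016/s0022-1236(03)00199-x, arXiv:1801.01389]
#3 NearConvexity (crux) — near-convexity of the periodic ground-state energy in N at fixed side: for
every bounded repulsive finite-range v and every tolerance κ > 0 there is ρ₀ > 0 such that for 0 < ρ
< ρ₀, eventually in N, with L = (N/ρ)^(1/3): 2E₀^per(N,L) ≤ E₀^per(N+1,L) + E₀^per(N−1,L) +
κ(2π/L)². It converts one-sided sector floors for N ± 1 particles into BECSectorGap's particle–hole
floor (foreseen there as the split child "NearConvexity", filed here). Bogoliubov: second difference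
= +8πa/L³(1+O(√(ρa³))) ≫ −κ(2π/L)²; free gas: 0 ≤ κ(2π/L)². [difficulty: L] (why it might fail:
E₀^per(·,L) is known in N only to LHY precision (errors O(Nρa(ρa³)^(1/2)) ≫ L⁻²); an N-parity or
commensurability oscillation of μ_N = E₀(N+1) − E₀(N) of size ≥ κ(2π/L)² at finite L would break it
— no printed convexity-in-N result for the 3-D gas.) [LSSY2005, CorneanDerezinskiZin2009,
LiebLiniger1963, arXiv:1904.06164, arXiv:1801.01389]
#4 BoundaryTransferWeak (crux) — shared verbatim with routes BECPeriodicReduction/BECSectorGap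
(stmt-AtomisticToContinuum-0827): for each repulsive finite-range v, constant-mode condensation of
δ-near-minimisers on the torus of side (N/ρ)^(1/3) at all small ρ implies ∃ρ₀ ∀ρ<ρ₀
HasGroundStateBEC v ρ (Dirichlet box, λ_max(γ) ≥ cN via condensateNumber). [difficulty: L] (why it
might fail: Dirichlet GS is a periodic trial state but lies a wall term ≫ δ above E₀^per, so the
torus hypothesis never fires directly; needs a structural (Neumann bracketing + mode-free λ_max ≥ tr
γ²/N) transfer not in print; BEC is BC-sensitive (Robinson 1976).) [LSSY2005, Fournais2020,
arXiv:2205.15284, arXiv:2603.20776, doi:10.1007/bf01608554]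
#5 ScatteringLengthTransfer (crux) — shared verbatim with route EqualScatteringTransfer
(stmt-AtomisticToContinuum-4285): for admissible v, w with v bounded and scatteringLength v =
scatteringLength w, small-density ground-state BEC for v implies small-density ground-state BEC for
w (hard cores allowed) — the card's HC flag "use soft representatives": the area mechanism needs p₀
= Φ² with Φ ∈ C¹ positive, which hard cores and r^(−α) cores (1 ≤ α < 2) do not have. [difficulty:
XL] (why it might fail: False iff LSSY's open question (Ch. 2 after (2.8)) resolves as "hard- and
soft-core gases of equal a differ w.r.t. BEC"; no cheap refutation (implied by the conjunct), but
every proof idea in hand runs through EqualScatteringTransfer's corrector bound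
CondensateComparison.) [LSSY2005, Dyson1957, doi:10.1103/PhysRev.98.1479, doi:10.1007/BF01210789]
#9 NodalLemma (support) — (card (T), Feynman's 1954 symmetry argument made topological; provable
now, of independent interest) for N bosons on the torus of side L > 0 and m ∈ ℤ³ with NOT (N ∣ m_t
for all t), every continuous F : (ℝ³)^N → ℂ that is Lℤ³-periodic in each particle,
permutation-symmetric and Bloch-equivariant F(X + s·𝟙) = e^(i(2π/L)m·s)F(X) has a zero. Proof: if F
≠ 0 everywhere, the winding number w of F along "particle j once around direction t" is independent
of j (symmetry) and of the base point (homotopy), and the diagonal loop X ↦ X + uLe_t𝟙 is homotopic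
in (ℝ³/Lℤ³)^N to the concatenation of the N single-particle loops, so its degree m_t equals N·w.
Sharp: for N ∣ m the boost e^(i(k/N)·Σx_j) is nodeless (Bloch 1973; Kanamoto–Carr–Ueda). Role: not
in the assembly chain; it gives J_F ≢ 0 for every C¹ admissible F in the window (J ≡ 0 means rank ≤
1, so the image is Lebesgue-null; but by equivariance it is rotation-invariant, connected, and
contains 0 and a point of modulus ≥ 1, hence the closed unit disc — contradiction) — the
qualitative, per-map form of VortexAreaFloor — and it is the topological obstruction that makes
exact calibrations of the diagonal momentum impossible, i.e. why the momentum–area identity must run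
through Feynman's mode planes. Mathlib route: covering map ℝ → AddCircle / Complex.exp, homotopy
lifting, additivity of degree on H₁ of the torus. [difficulty: L] [Feynman1954, arXiv:0910.2805,
doi:10.1103/PhysRevA.7.2187]
#9 TorusGroundState (support) — (construction statement for the posited interface; known
mathematics, heavy in Lean) for bounded repulsive finite-range v, every N and every L > 0 there is a
periodic C¹ trial state Φ of N bosons on the torus of side L attaining E₀^per(N,L) < ∞, with Φ real
and strictly positive everywhere and invariant under diagonal translations X ↦ X + s𝟙. Proof: v^per
is bounded (finitely many images), H = −Δ + V^per on (ℝ³/Lℤ³)^N has compact resolvent and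
positivity-improving heat semigroup, so the ground state is unique, strictly positive (Harnack),
hence permutation-symmetric and translation-invariant; W^(2,p) regularity for all p < ∞ gives Φ ∈
C^(1,α), so Φ lies in the C¹ class and its energy is the infimum over the C¹ form core. Existence is
deliberately NOT smuggled into the interface hypotheses of
VortexAreaFloor/GroundStateRepresentation. [difficulty: XL] [ReedSimonIV1978, GilbargTrudinger2001,
CorneanDerezinskiZin2009]
#9 GroundStateRepresentation (support) — (ground-state transform identity; provable now) for bounded
repulsive finite-range v, any periodic C¹ trial state Φ attaining E₀^per(N,L) < ∞ with Φ real
positive, and any C¹ map F that is Lℤ³-periodic in each particle and permutation-symmetric: ∫_cell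
(|∇(FΦ)|² + V^per|FΦ|²) = E₀^per(N,L)·∫_cell |F|²Φ² + ∫_cell |∇F|²Φ² (all terms in ℝ≥0∞, no
subtraction). Proof: expand |∇(FΦ)|² = |∇F|²Φ² + ∇|F|²·Φ∇Φ + |F|²|∇Φ|² and use the weak
Euler–Lagrange equation of the minimiser Φ within the C¹ symmetric periodic class tested against η =
|F|²Φ. Shared object with card sector-poincare-two-scale's (SP_k). [difficulty: L] [ReedSimonIV1978,
CorneanDerezinskiZin2009, Feynman1954]
#9 VortexAreaToPeriodicBEC (support) — (glue, provable now) VortexAreaFloor → TorusGroundState →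
GroundStateRepresentation → NearConvexity → ZeroMomentumGround → MomentBoundCondensation →
FreeGasCondensation → for every bounded repulsive finite-range v, the PeriodicBEC body for v. Proof:
if ∫v = 0 use FreeGasCondensation. Else fix C > 0; VortexAreaFloor with Λ = 1 gives c, put κ₁ =
min(1, 2c), κ = κ₁/2; for a Bloch-k periodic trial state Ψ of N ± 1 particles at L = (N/ρ)^(1/3) put
F = Ψ/Φ (Φ from TorusGroundState; F is C¹, periodic, symmetric, Bloch-k because Φ is
translation-invariant, ∫|F|²Φ² = 1): periodicEnergy Ψ = E₀ + ∫|∇F|²Φ² (GroundStateRepresentation)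
and pointwise |∇F|² ≥ 2J_F (Gram determinant ≤ product of the diagonal entries, AM–GM), so either
∫|∇F|²Φ² ≥ |k|² or ∫|∇F|²Φ² ≥ 2∫J_FΦ² ≥ 2c|k|²; hence E_(N±1)(k) ≥ E₀(N±1) + κ₁|k|²; a non-empty
Bloch class forces k ∈ (2π/L)ℤ³, so |k| ≥ 2π/L, and NearConvexity at tolerance κ₁ yields 2E₀(N) +
2κ|k|² ≤ E_(N+1)(k) + E_(N−1)(k), the SectorGapFloor body for v; boundedness + finite range give ∫v
< ∞, ZeroMomentumGround gives the zero-momentum gap and MomentBoundCondensation concludes.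
[difficulty: L] [Feynman1954, Stringari1995, Wagner1966, CorneanDerezinskiZin2009]
#9 ZeroMomentumGround (support) — shared verbatim with route BECSectorGap
(stmt-AtomisticToContinuum-5151): qualitative zero-momentum gap at fixed (N, L) for integrable v —
E₀^per(N,L) < E^per_N(q;L) for q ≠ 0 (Perron–Frobenius; ⊤ off the dual lattice). [difficulty: XL]
[ReedSimonIV1978, CorneanDerezinskiZin2009]
#9 MomentBoundCondensation (support) — shared verbatim with route BECSectorGap
(stmt-AtomisticToContinuum-5152): for integrable v ≢ 0, zero-momentum gap → particle–hole sector
floor → PeriodicBEC body (Wagner–Feynman moment bound read backwards n_k·Γ_N(k) ≤ k² + 2ρ‖v‖₁,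
Parseval, d = 3 lattice count). [difficulty: XL] [Stringari1995, Wagner1966,
PitaevskiiStringari1991, CorneanDerezinskiZin2009]
#9 FreeGasCondensation (support) — shared verbatim with route BECSectorGap
(stmt-AtomisticToContinuum-5153): the a.e.-free gas (∫v = 0) condenses on the torus (Parseval +
Bessel). [difficulty: M] [LSSY2005]
#9 RepresentativesExist (support) — shared verbatim with route EqualScatteringTransfer
(stmt-AtomisticToContinuum-4287): every real a ≥ 0 is the scattering length of a bounded admissible
profile (top-hat, intermediate value theorem). [difficulty: M] [LSSY2005]
#9 ScatteringLengthFinite (support) — shared verbatim with route EqualScatteringTransfer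
(stmt-AtomisticToContinuum-0851): finite range ⇒ scatteringLength v ≠ ⊤. [difficulty: provable-now]
[LSSY2005]

TWO-LAYER PLAN. Foreseen glued split of the rank-2 crux (none filed now; k = 3, depth 1),
transplanting the Gaussian-level proof to the true p₀:
VortexAreaFloor ⇐ JacobianL1 (pure linear algebra, provable: for any family of mutually orthogonal
2-plane fields Π_a(X) ⊂ ℝ^(3N),
J_F ≥ Σ_a |det(dF|Π_a)|; Gram expansion plus √((C_a²+d_a²)(C_b²+d_b²)) ≥ |C_aC_b| + d_ad_b) →
MomentumAreaIdentity (exact bookkeeping: for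
admissible F, (k·ê)‖F‖² = ⟨F, ê·P F⟩_(p₀) rewritten by integration by parts against p₀ with the
ground-state generator 𝓛 = Δ + 2∇log Φ·∇
along near-orthogonalised Feynman plane fields of the modes |q| ≤ Q as Σ_q (q·ê)(S(q)/q²)·(signed
Π_q-area of dF)·2 + R_Q(F), the remainder
collecting (𝓛 + ε_q)ρ_q (backflow), plane overlaps ⟨∇ρ_q,∇ρ_q′⟩ = −q·q′ρ_(q+q′) and modes > Q) →
RemainderControl (the real crux inside: |R_Q(F)|
≤ ½|k|‖F‖² for maps of energy ≤ Λ|k|², using the hyperuniformity ceiling S(q) ≤ C|q|ξ down to 2π/L —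
torus twin of BECSwapAffinity's
GroundStateHyperuniformity — and an L²-bound on backflow corrections) → VortexAreaFloor with c =
v_F/(4√(Cρ))-type constants. Also
NearConvexity ⇐ ChemicalPotentialMonotone (μ_N(L) non-decreasing up to o(L⁻²)) → NearConvexity;
VortexAreaToPeriodicBEC ⇐ OneSidedSectorFloor
(E_M(k) ≥ E₀(M) + κ₁|k|², M = N ± 1, bounded v) → ParticleHoleFloor → VortexAreaToPeriodicBEC —
OneSidedSectorFloor is the meeting point with
BECSectorGap's foreseen split and a future sector-poincare-two-scale route.

KILL CRITERIA. ¬VortexAreaFloor — a family of admissible maps in the window with energy ≤ Λ|k|² and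
Jacobian mass o(|k|²) uniformly (an "area-cheap" way
to carry momentum: real and imaginary gradients parallel on almost all of p₀, e.g. found by the ED
falsifier or by a Bogoliubov-level
computation including the non-Gaussian three-phonon vertex) — closes the route
`refuted:VortexAreaFloor`; note it would NOT refute Landau
(area ≤ energy/2 only), so the Landau line (BECSectorGap, sector-poincare-two-scale) survives but
loses its geometric certificate. A proof
that S(2π/L) does not vanish as L → ∞ (no hyperuniformity at the lowest mode on the torus) kills
RemainderControl and forces the window to
start above (ρa)^(1/2)·(ρa³)^γ — pivot by restating the window, since MomentBoundCondensation
tolerates an infrared cut only if the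
excluded shells are handled by FreeGas-type Chebyshev (check first). ¬NearConvexity forces the
bridge into the N-particle sector
(Bijl–Feynman ω_N ≤ k²/S turns a linear area floor into the hyperuniformity ceiling wanted by
BECSwapAffinity) or closes the route.
¬BoundaryTransferWeak kills this route with BECPeriodicReduction/BECSectorGap's tails, not the
conjunct; ¬ScatteringLengthTransfer kills the
soft-representative strategy — pivot to BECSectorGap's HardCoreMomentBound (stmt-5150) with a
contact-weighted area, else close.
¬TorusGroundState / ¬GroundStateRepresentation / ¬NodalLemma can only mean a misformalised interface
clause — restate, do not close.
SectorGapFloor (stmt-5149) or PeriodicBEC (stmt-0826) proved by any route moots ranks 2–3 (close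
`superseded`).

NOT DECOMPOSED YET. The three children of VortexAreaFloor above (only after a refuter pass on the
parent); the LINEAR floor ½v_F|k| suggested by the Gaussian
model and the Feynman-normalised scale k²/S(k) are NOT filed (the quadratic floor on |k|² ≤ Cρ is
the weakest form the assembly needs);
the unit-disc / inf-fibre waist of the card is NOT filed (false, see Cheapest falsifier); Lean
infrastructure of NodalLemma (degree of circle
maps, homotopy lifting), TorusGroundState (Perron–Frobenius on the torus, W^(2,p) regularity) and
VortexAreaToPeriodicBEC (quotient rule for
fderiv, Gram-determinant inequality, dual lattice from a non-empty Bloch class, lintegral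
bookkeeping) rides as `--supports` helpers,
never items; hard cores only through ScatteringLengthTransfer; no T > 0, no d ≠ 3, canonical torus
only.

CHEAPEST FALSIFIER. RUN ON PAPER THIS SESSION (killed the card's form, fixed the filed one): with G
= ρ_q/√(NS(q)), q = (2π/L)e₁ (≈ complex Gaussian under
p₀) and F_n = Gⁿ/√(n!), n = m₁: admissible, ‖F_n‖ = 1, energy nε_q ≈ c_s|k| ≤ k²/S(k) (in the card's
class for Λ ≥ 1), but fibre density
M_(F_n)(z) = n(ε_q/2π)exp(−(|z|²n!)^(1/n)) ≈ (c_s|k|/2π)e^(−n/e) on |z| ≍ 1 and Jacobian mass in the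
unit disc ≈ (c_s|k|/2)P(Γ_n ≤ n/e) ≈
e^(−n/e), n = |k|L/2π → ∞: the unit-disc waist is not bounded below uniformly in L. The TOTAL
Jacobian mass of F_n is c_s|k|/2 = energy/2,
and E[J_(φ∘G)] = (ε/2)‖φ∘G‖² for every equivariant reparametrisation φ(w) = ψ(|w|)e^(i arg w) — why
the total area is filed. Cheapest
remaining kills: (i) kit ED, N = 5–8 lattice bosons on 4³–6³ tori at low filling, sector m =
(1,0,0): ∫J_FΨ₀²/|k|² and ∫|∇F|²Ψ₀²/|k|² for
F = Ψ_k/Ψ₀ versus filling and L (ratio → 0 inside the energy class kills VortexAreaFloor); (ii)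
Bogoliubov-with-cubic-vertex computation of
inf E[J_F]/‖F‖² over two-phonon maps Σ_q c_q ρ_(k−q)ρ_q with the exact plane overlaps −q·q′ρ_(q+q′)
(parametric decay in the number of modes
kills RemainderControl); (iii) NearConvexity lookup (crossref/zbMATH: none for d = 3).

NUMBERS. Units ħ = 2m = 1. Bogoliubov: E_k = √(k⁴ + 16πaρk²), c_s = (16πaρ)^(1/2), ξ =
(8πρa)^(−1/2), S(k) = k²/E_k, v_F := inf_q |q|/S(q) = inf_q
E_q/|q| = c_s (Landau's critical velocity in Bijl–Feynman form). Gaussian-level theorem (this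
session): E[J_F] ≥ ½v_F|k|·‖F‖² for every
admissible F, so on |k|² ≤ Cρ the filed quadratic floor holds there with c = c_s/(2√(Cρ)) =
(4πa/C)^(1/2), ρ- and N-free. Test maps:
Feynman ρ_k/√(NS): |∇ρ_k|² ≡ Nk², energy k²/S(k) = E_k, E[J] = E_k/2; F_n = (ρ_q)ⁿ/√(n!): energy
nε_q = c_s|k|(1+O((kξ/n)²)), E[J] =
energy/2, unit-disc fibres e^(−n/e)-thin; peak-tracking relay e^(ik·c(X)) with c the maximum of the
density smoothed at q_s⁻¹: bulk J ≡ 0,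
|∇_X c|² ≈ 1/S(q_s) (hyperuniform stiffness), energy ≈ (k² + q_s²)/S(q_s) ≥ k²/S(k), E[J] ≈
|k|q_s/S(q_s) ≥ v_F|k| from the compulsory far
hand-overs; free gas (excluded): e_n maps, energy (2π/L)|k|, E[J] = π|k|/L. Downstream any κ > 0
suffices (MomentBoundCondensation uses C =
4‖v‖₁; Bogoliubov allows κ ≤ (πa/‖v‖₁)^(1/2)). NearConvexity: Bogoliubov second difference 8πa/L³ vs
tolerance κ(2π/L)², ratio κπL/(2a) →
∞. Nodal lemma sharpness: N ∣ m ⇒ nodeless boost, ω = k²/N. Window |k|² ≤ Cρ stays below the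
vortex-ring scale π/(8a) for ρ < ρ₀(C). Items at
open: 14 (4 cruxes, 9 supports, 1 assembly).

DEFINITION REQUESTS. None blocking: the ground-state interface (periodic C¹ minimiser, real
positive, diagonally translation-invariant) and the 2-Jacobian
(Gram determinant of (∇Re F, ∇Im F) via `fderiv` along `Pi.single i (EuclideanSpace.single t 1)`)
are inlined (Sketch.lean rc 0).
Nice-to-have, to be filed after open (non-blocking): `BoseGas.IsPeriodicGroundState v N L Φ`,
`BoseGas.jacobianDensity F X`, the Bloch-sector
infimum `momentumSectorEnergy v M L k` (shared wish with BECSectorGap), and a structure-factor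
`BoseGas.structureFactor N L Ψ q` (shared with
BECSwapAffinity's inlined variance). Bib entries Gromov2003, Klartag2017, JerrardSoner2002,
AkopyanKarasev2020 fetched with `lit cite`
(k.bib in the planner folder); `ledger bib add` timed out at 12:25Z and is to be retried.

Novelty: Searches (2026-08-15, this seat): `lit frontier AtomisticToContinuum --since 2020` (30 rows: Junge
arXiv:2603.20776, Chong–Liang–Nam
arXiv:2510.20493 "kinetic localization via Poincaré-type inequalities" — no thermodynamic-limit
sector spectra, no nodal/Jacobian geometry);
`lit bridges AtomisticToContinuum --cross any` (30 rows, none relevant); `lit search --source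
zbmath` ×4: "waist inequality Gromov measures
maps" (1: Gromov2003 = doi:10.1007/s000390300004), "yrast Bose gas total momentum" (1:
Lieb–Seiringer–Yngvason arXiv:0904.1750, GP-regime
rotating yrast line), "Jacobian vortex Ginzburg-Landau lower bound coarea" (0), "convexity ground
state energy particle number bosons" (0);
`lit search --source crossref` ×5: "Jacobian estimate Ginzburg-Landau functional Jerrard Soner" (8:
JerrardSoner2002 =
doi:10.1006/jfan.2001.3906, Jerrard–Spirn doi:10.1512/iumj.2007.56.2815, Sandier–Serfaty
doi:10.1016/s0022-1236(03)00199-x, BJOS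
doi:10.1007/s00205-012-0527-2), "waist of measures Akopyan Karasev" (8: AkopyanKarasev2020 =
doi:10.1007/978-3-030-36020-7_1), "excitation
spectrum Bose gas thermodynamic limit Landau" (8: only Lieb1963 = doi:10.1103/physrev.130.1616
rigorous, d = 1), "convexity of the ground
state energy in the particle number" (8: none for the dilute Bose gas), "waist inequality Gaussian
measure fibers maps to the plane Gromov"
(10: optics / correlation-inequality noise); local searchd, arXiv and S2 unavailable or HTTP 429 all
session (NOTES.md); plus the card's own
se  [refs: 10.1007/s000390300004, 10.1006/jfan.2001.3906, 10.1512/iumj.2007.56.2815, 10.1016/s0022-1236(03, 10.1007/s00205-012-0527-2, 10.1007/978-3-030-36020-7_1, 10.1103/physrev.130.1616, 10.1103/physrev.94.262, 10.1103/PhysRev.102.1189, 10.1007/s00039-017-0397-8, 10.1063/1.3129489:, 2603.20776, 2510.20493, 0904.1750, 0910.2805, doi:10.1007/s000390300004, doi:10.1006/jfan.2001.3906, doi:10.1512/iumj.2007.5]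

Barriers (technique_class: waist-inequality, coarea, degree-theory, calibration): - technique_class: waist-inequality, coarea, degree-theory, calibration
- Literature.Barriers.AtomisticToContinuum.KineticGapLengthScales: evaded in kind — no one-body
kinetic gap and no step "depletion ≤ L² × excess energy"; the object floored is the MANY-body sector
energy at |k| ≥ 2π/L, uniformly in L, by the p₀-weighted area of forced vortex sheets; the bridge to
BEC is the per-sector moment bound (each mode pays 1/Γ_N(k) of its OWN sector:
Σ_(0<|k|≤K)(k²+3ρ‖v‖₁)/(2κk²) ≤ C_v N ρ^(1/2)/κ = o(N) as ρ → 0 in d = 3). Honest: the barrier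
re-enters if RemainderControl is attempted by spatial energy localisation with extensive errors —
which is why the foreseen proof integrates by parts GLOBALLY along mode plane fields (errors
measured in L²(p₀) against the map itself, not per box).
- Literature.Barriers.AtomisticToContinuum.EnergyAsymptoticsWithoutCondensation: respected — the
energy VALUE never enters (only E₀ ≤ ½ρ‖v‖₁N inside MomentBoundCondensation's UV tail and the
qualitative NearConvexity at tolerance o(L⁻²), two orders cruder than LHY); what enters is the
structure of p₀ (translation invariance, hyperuniformity, backflow). The 1-D Lieb–Liniger witness is
reproduced: NodalLemma and (at Gaussian level) the area floor hold in d = 1 (linear type-II yrast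
branch), and BEC fails only at the d = 3 lattice count inside MomentBoundCondensation, as it must.
- Literature.Barriers.AtomisticToContinuum.BogoliubovPerturbationInfrared: not met — no expansion
around a Bogoliubov state;

Novelty grade: new-mechanism — ROUTE REVIEW (refuter f3b46551, 2026-08-15; route already CLOSED-retired 13:38Z by D-0027 §2.1 audit for ending in Literature…BoseGas.BoseEinsteinCondensation instead of the Summit abbrev — a syntactic defect only; this note is for the conforming re-open). Verdict: KEEP-WORTHY LINE. (1) All 7 new de (refuter refuter-rreview-route-AtomisticToContinu-f3b46551-0, 2026-08-15T13:56:58Z; prior: Feynman1954, CorneanDerezinskiZin2009, doi:10.1006/jfan.2001.3906, doi:10.1007/s000390300004, Stringari1995)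

History (route lifecycle, newest last):
- 2026-08-15T13:38:43Z · CLOSED retired — not-a-thesis: assembly does not conclude the sub-problem Statement (operator:999:1257524)

sub-problem: BoseEinsteinCondensation · status: closed(retired) · opened planner-plancard-AtomisticToContinuum-BoseEin-d4a4dff5-0 2026-08-15T12:31:39Z · rev 0 · ledger route-AtomisticToContinuum-BECFeynmanWaist
GENERATED by the gate from the ledger (D-0016/17). Provers cite these decls: `theorem foo : Summit.AtomisticToContinuum.BoseEinsteinCondensation.Theses.BECFeynmanWaist.<Decl> := …` in Summits/AtomisticToContinuum/BoseEinsteinCondensation/Theorems/<Name>.lean.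
-/

namespace Summit.AtomisticToContinuum.BoseEinsteinCondensation.Theses.BECFeynmanWaist

open scoped BigOperators Topology Manifold Classical MeasureTheory ProbabilityTheory Matrix InnerProductSpace ComplexConjugate ContinuousMap
open Filter Set Function TopologicalSpace MeasureTheory

attribute [summit_statement] _root_.BoseEinsteinCondensation

/-- item stmt-AtomisticToContinuum-8139 · crux · rank 2 · closed · moot by None · by planner
why it might fail: Beyond the Gaussian model the momentum–area identity has a remainder ((𝓛+ε_q)ρ_q ≠ 0: Feynman–Cohen backflow, non-orthogonal planes, UV modes) that must stay below the main term uniformly in N — as hard as Landau plus S(q) ≤ C|q|ξ down to 2π/L; c decays in C.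
sources: Feynman1954, CorneanDerezinskiZin2009, doi:10.1103/PhysRev.102.1189, doi:10.1007/s000390300004, doi:10.1007/s00039-017-0397-8, doi:10.1006/jfan.2001.3906
[crux] (card FW, corrected: total vortex area instead of unit-disc waist) for every bounded
repulsive finite-range v with ∫v ≠ 0 and all C, Λ > 0 there are c, ρ₀ > 0 such that for 0 < ρ < ρ₀,
eventually in L, for every N with N/L³ ∈ [ρ/2, 2ρ], every positive translation-invariant periodic C¹
ground state Φ of N bosons on the torus of side L (energy = E₀^per(N,L) < ∞), every k ≠ 0 with |k|²
≤ Cρ and every C¹ periodic symmetric Bloch-k map F with ∫_cell |F|²Φ² = 1 and ∫_cell |∇F|²Φ² ≤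
Λ|k|²: c|k|² ≤ ∫_cell J_F Φ² with J_F = ((Σ(Re ∂F)²)(Σ(Im ∂F)²) − (Σ Re ∂F·Im ∂F)²)^(1/2) the
2-Jacobian (area element of dRe F ∧ dIm F). Gaussian level: ≥ ½c_s|k| (linear); Feynman's map and
the multi-quantum maps (ρ_q)ⁿ/√(n!) give energy/2; peak-tracking relays e^(ik·c(X)) give
|k|q_s/S(q_s) ≥ c_s|k|; the free gas violates it (eₙ maps: π|k|/L), hence ∫v ≠ 0. [difficulty:
open-problem] -/
@[route_item "route-AtomisticToContinuum-BECFeynmanWaist"]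
def VortexAreaFloor : Prop :=
  ∀ v : ℝ → ENNReal, Literature.MathematicalPhysics.QuantumManyBody.BoseGas.IsRepulsiveFiniteRange v → (∃ M : NNReal, ∀ r, v r ≤ M) → (∫⁻ x : EuclideanSpace ℝ (Fin 3), v ‖x‖) ≠ 0 → ∀ C : ℝ, 0 < C → ∀ Λ : ℝ, 0 < Λ → ∃ c : ℝ, 0 < c ∧ ∃ ρ₀ : ℝ, 0 < ρ₀ ∧ ∀ ρ : ℝ, 0 < ρ → ρ < ρ₀ → ∀ᶠ L : ℝ in Filter.atTop, ∀ N : ℕ, ρ / 2 ≤ (N : ℝ) / L ^ 3 → (N : ℝ) / L ^ 3 ≤ 2 * ρ → ∀ Φ : Literature.MathematicalPhysics.QuantumManyBody.BoseGas.PeriodicTrialState N L, Literature.MathematicalPhysics.QuantumManyBody.BoseGas.periodicEnergy v Φ = Literature.MathematicalPhysics.QuantumManyBody.BoseGas.periodicGroundStateEnergy v N L → Literature.MathematicalPhysics.QuantumManyBody.BoseGas.periodicGroundStateEnergy v N L ≠ ⊤ → (∀ X, 0 < (Φ.ψ X).re ∧ (Φ.ψ X).im = 0) → (∀ (s : EuclideanSpace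 ℝ (Fin 3)) (X : Fin N → EuclideanSpace ℝ (Fin 3)), Φ.ψ (fun i => X i + s) = Φ.ψ X) → ∀ k : EuclideanSpace ℝ (Fin 3), k ≠ 0 → ‖k‖ ^ 2 ≤ C * ρ → ∀ F : (Fin N → EuclideanSpace ℝ (Fin 3)) → ℂ, ContDiff ℝ 1 F → (∀ (X : Fin N → EuclideanSpace ℝ (Fin 3)) (i : Fin N) (t : Fin 3), F (X + Pi.single i (EuclideanSpace.single t L)) = F X) → (∀ (σ : Equiv.Perm (Fin N)) (X : Fin N → EuclideanSpace ℝ (Fin 3)), F (X ∘ σ) = F X) → (∀ (s : EuclideanSpace ℝ (Fin 3)) (X : Fin N → EuclideanSpace ℝ (Fin 3)), F (fun i => X i + s) = Complex.exp (Complex.I * ↑(∑ j, k j * s j)) * F X) → ∫⁻ X in Literature.MathematicalPhysics.QuantumManyBody.BoseGas.cellN N L, (‖F X‖₊ : ENNReal) ^ 2 * (‖Φ.ψ X‖₊ : ENNReal) ^ 2 = 1 → ∫⁻ X in Literature.MathematicalPhysics.QuantumManyBody.BoseGas.cellN N L, Literature.MathematicalPhysics.QuantumManyBody.BoseGas.kineticDensity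 F X * (‖Φ.ψ X‖₊ : ENNReal) ^ 2 ≤ ENNReal.ofReal (Λ * ‖k‖ ^ 2) → ENNReal.ofReal (c * ‖k‖ ^ 2) ≤ ∫⁻ X in Literature.MathematicalPhysics.QuantumManyBody.BoseGas.cellN N L, ENNReal.ofReal (Real.sqrt ((∑ i, ∑ t, (fderiv ℝ F X (Pi.single i (EuclideanSpace.single t (1 : ℝ)))).re ^ 2) * (∑ i, ∑ t, (fderiv ℝ F X (Pi.single i (EuclideanSpace.single t (1 : ℝ)))).im ^ 2) - (∑ i, ∑ t, (fderiv ℝ F X (Pi.single i (EuclideanSpace.single t (1 : ℝ)))).re * (fderiv ℝ F X (Pi.single i (EuclideanSpace.single t (1 : ℝ)))).im) ^ 2)) * (‖Φ.ψ X‖₊ : ENNReal) ^ 2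

/-- item stmt-AtomisticToContinuum-8140 · crux · rank 3 · closed · moot by None · by planner
why it might fail: E₀^per(·,L) is known in N only to LHY precision (errors O(Nρa(ρa³)^(1/2)) ≫ L⁻²); an N-parity or commensurability oscillation of μ_N = E₀(N+1) − E₀(N) of size ≥ κ(2π/L)² at finite L would break it — no printed convexity-in-N result for the 3-D gas.
sources: LSSY2005, CorneanDerezinskiZin2009, LiebLiniger1963, arXiv:1904.06164, arXiv:1801.01389
[crux] near-convexity of the periodic ground-state energy in N at fixed side: for every bounded
repulsive finite-range v and every tolerance κ > 0 there is ρ₀ > 0 such that for 0 < ρ < ρ₀,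
eventually in N, with L = (N/ρ)^(1/3): 2E₀^per(N,L) ≤ E₀^per(N+1,L) + E₀^per(N−1,L) + κ(2π/L)². It
converts one-sided sector floors for N ± 1 particles into BECSectorGap's particle–hole floor
(foreseen there as the split child "NearConvexity", filed here). Bogoliubov: second difference =
+8πa/L³(1+O(√(ρa³))) ≫ −κ(2π/L)²; free gas: 0 ≤ κ(2π/L)². [difficulty: L] -/
@[route_item "route-AtomisticToContinuum-BECFeynmanWaist"]
def NearConvexity : Prop :=
  ∀ v : ℝ → ENNReal, Literature.MathematicalPhysics.QuantumManyBody.BoseGas.IsRepulsiveFiniteRange v → (∃ M : NNReal, ∀ r, v r ≤ M) → ∀ κ : ℝ, 0 < κ → ∃ ρ₀ : ℝ, 0 < ρ₀ ∧ ∀ ρ : ℝ, 0 < ρ → ρ < ρ₀ → ∀ᶠ N : ℕ in Filter.atTop, 2 * Literature.MathematicalPhysics.QuantumManyBody.BoseGas.periodicGroundStateEnergy v N (Literature.MathematicalPhysics.QuantumManyBody.BoseGas.sideLength ρ N) ≤ Literature.MathematicalPhysics.QuantumManyBody.BoseGas.periodicGroundStateEnergy v (N + 1) (Literature.MathematicalPhysics.QuantumManyBody.BoseGas.sideLength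 ρ N) + Literature.MathematicalPhysics.QuantumManyBody.BoseGas.periodicGroundStateEnergy v (N - 1) (Literature.MathematicalPhysics.QuantumManyBody.BoseGas.sideLength ρ N) + ENNReal.ofReal (κ * (2 * Real.pi / Literature.MathematicalPhysics.QuantumManyBody.BoseGas.sideLength ρ N) ^ 2)

/-- item stmt-AtomisticToContinuum-0827 · crux · rank 4 · open · by planner
why it might fail: Dirichlet GS is a periodic trial state but lies a wall term ≫ δ above E₀^per, so the torus hypothesis never fires directly; needs a structural (Neumann bracketing + mode-free λ_max ≥ tr γ²/N) transfer not in print; BEC is BC-sensitive (Robinson 1976).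
sources: LSSY2005, Fournais2020, arXiv:2205.15284, arXiv:2603.20776, doi:10.1007/bf01608554
[crux] BoundaryTransferWeak (mode-free boundary-condition transfer, per potential): for each
repulsive finite-range v, PeriodicBEC(v) implies ∃ρ₀>0 ∀ρ∈(0,ρ₀) HasGroundStateBEC v ρ (Dirichlet
ground state, λ_max(γ) ≥ cN via condensateNumber). Not glue: near-minimiser slacks are O(N/L²) while
Dirichlet/periodic energies differ by a boundary term ≫ N/L², so no energy-comparison proof;
expected route: Neumann bracketing of interior sub-boxes (−Δ_Dir ≥ ⊕−Δ_Neu, v ≥ 0) + a mode-free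
criterion (λ_max ≥ tr γ²/N). Only the ENERGY analogue is in print (LiebSeiringerSolovejYngvason2005
Ch. 2 after (2.8)). v ≡ 0: hypothesis and conclusion both true. -/
@[route_item "route-AtomisticToContinuum-BECFeynmanWaist"]
def BoundaryTransferWeak : Prop :=
  ∀ v : ℝ → ENNReal, Literature.MathematicalPhysics.QuantumManyBody.BoseGas.IsRepulsiveFiniteRange v → (∃ ρ₀ : ℝ, 0 < ρ₀ ∧ ∀ ρ : ℝ, 0 < ρ → ρ < ρ₀ → ∃ c : ℝ, 0 < c ∧ ∀ᶠ N : ℕ in Filter.atTop, ∃ δ : ENNReal, 0 < δ ∧ ∀ Ψ : Literature.MathematicalPhysics.QuantumManyBody.BoseGas.PeriodicTrialState N (Literature.MathematicalPhysics.QuantumManyBody.BoseGas.sideLength ρ N), Literature.MathematicalPhysics.QuantumManyBody.BoseGas.periodicEnergy v Ψ ≤ Literature.MathematicalPhysics.QuantumManyBody.BoseGas.periodicGroundStateEnergy v N (Literature.MathematicalPhysics.QuantumManyBody.BoseGas.sideLength ρ N) + δ → ENNReal.ofReal (c * N) ≤ Literature.MathematicalPhysics.QuantumManyBody.BoseGas.condensateOccupation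 N (Literature.MathematicalPhysics.QuantumManyBody.BoseGas.sideLength ρ N) Ψ.ψ) → ∃ ρ₀ : ℝ, 0 < ρ₀ ∧ ∀ ρ : ℝ, 0 < ρ → ρ < ρ₀ → Literature.MathematicalPhysics.QuantumManyBody.BoseGas.HasGroundStateBEC v ρ

/-- item stmt-AtomisticToContinuum-4285 · crux · rank 5 · closed · moot by None · by planner
why it might fail: False iff LSSY's open question (Ch. 2 after (2.8)) resolves as "hard- and soft-core gases of equal a differ w.r.t. BEC"; no cheap refutation (implied by the conjunct), but every proof idea in hand runs through EqualScatteringTransfer's corrector bound CondensateComparison.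
sources: LSSY2005, Dyson1957, doi:10.1103/PhysRev.98.1479, doi:10.1007/BF01210789
[crux] X_T — for admissible v, w with v bounded and scatteringLength v = scatteringLength w: (∃ ρ₀ >
0, ∀ ρ ∈ (0,ρ₀), HasGroundStateBEC v ρ) → (∃ ρ₀' > 0, ∀ ρ ∈ (0,ρ₀'), HasGroundStateBEC w ρ). The
assembly's hypothesis; follows from CondensateComparison at L = (N/ρ)^{1/3} (glue
ComparisonImpliesTransfer) but may also be proved qualitatively. [difficulty: XL] -/
@[route_item "route-AtomisticToContinuum-BECFeynmanWaist"]
def ScatteringLengthTransfer : Prop :=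
  ∀ v w : ℝ → ENNReal, Literature.MathematicalPhysics.QuantumManyBody.BoseGas.IsRepulsiveFiniteRange v → Literature.MathematicalPhysics.QuantumManyBody.BoseGas.IsRepulsiveFiniteRange w → (∃ M : NNReal, ∀ r, v r ≤ M) → Literature.MathematicalPhysics.QuantumManyBody.BoseGas.scatteringLength v = Literature.MathematicalPhysics.QuantumManyBody.BoseGas.scatteringLength w → (∃ ρ₀ : ℝ, 0 < ρ₀ ∧ ∀ ρ : ℝ, 0 < ρ → ρ < ρ₀ → Literature.MathematicalPhysics.QuantumManyBody.BoseGas.HasGroundStateBEC v ρ) → ∃ ρ₀ : ℝ, 0 < ρ₀ ∧ ∀ ρ : ℝ, 0 < ρ → ρ < ρ₀ → Literature.MathematicalPhysics.QuantumManyBody.BoseGas.HasGroundStateBEC w ρ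

/-- item stmt-AtomisticToContinuum-0851 · support · rank 9 · closed · moot by None · by planner
sources: LSSY2005
[support] ScatteringLengthFinite: finite range R₀ ⇒ scatteringLength v ≠ ⊤ (indeed a ≤ R₀+ε: trial φ
∈ C¹, φ = 0 on B_{R₀}, φ = 1 off B_{R₀+ε}, so v·φ² = 0 incl. hard cores since ⊤·0 = 0).
[LiebSeiringerSolovejYngvason2005 App. C, Thm C.1 and Remark; scatteringLength_le] -/
@[route_item "route-AtomisticToContinuum-BECFeynmanWaist"]
def ScatteringLengthFinite : Prop :=
  ∀ v : ℝ → ENNReal, Literature.MathematicalPhysics.QuantumManyBody.BoseGas.IsRepulsiveFiniteRange v → Literature.MathematicalPhysics.QuantumManyBody.BoseGas.scatteringLength v ≠ ⊤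

/-- item stmt-AtomisticToContinuum-4287 · support · rank 9 · closed · moot by None · by planner
sources: LSSY2005
[support] every real a ≥ 0 is the scattering length of a bounded admissible profile (top-hat
λ·1_{[0,R]} with R = 2a: λ ↦ odeScatteringLength is continuous, 0 at λ = 0, → R(1 −
tanh(√(λ/2)R)/(√(λ/2)R)) ↑ R; intermediate value theorem; a = 0 ↦ v = 0) — the existence half of
RepresentativeBEC, over scatteringLength_eq_ofReal_odeScatteringLength. [difficulty: M] -/
@[route_item "route-AtomisticToContinuum-BECFeynmanWaist"]
def RepresentativesExist : Prop :=
  ∀ a : ℝ, 0 ≤ a → ∃ v : ℝ → ENNReal, Literature.MathematicalPhysics.QuantumManyBody.BoseGas.IsRepulsiveFiniteRange v ∧ (∃ M : NNReal, ∀ r, v r ≤ M) ∧ Literature.MathematicalPhysics.QuantumManyBody.BoseGas.scatteringLength v = ENNReal.ofReal a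

/-- item stmt-AtomisticToContinuum-5151 · support · rank 9 · closed · moot by None · by planner
sources: ReedSimonIV1978, CorneanDerezinskiZin2009
[support] qualitative zero-momentum gap at fixed (N, L) for integrable v (Perron–Frobenius): for
repulsive finite-range v with ∫v(|x|)dx < ∞, every N, every L > 0 and every q ≠ 0, E₀^per(N,L) <
E^per_N(q;L) (strict; ⊤ on the right off the dual lattice; N = 0 and L-empty cases hold vacuously/by
⊤). Proof: compact resolvent on the torus, positivity-improving e^{−tH} for 0 ≤ V ∈ L¹_loc
(ReedSimonIV1978 XIII.44–47, XIII.12) ⇒ unique positive, hence translation-invariant, ground state;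
the sector-q infimum is attained, so equality would give a second ground state. Variational
substitute: H¹ minimiser + diamagnetic inequality + Harnack. Heavy in Lean (no many-body operators
in Mathlib) but no open mathematics. [difficulty: XL] -/
@[route_item "route-AtomisticToContinuum-BECFeynmanWaist"]
def ZeroMomentumGround : Prop :=
  ∀ v : ℝ → ENNReal, Literature.MathematicalPhysics.QuantumManyBody.BoseGas.IsRepulsiveFiniteRange v → (∫⁻ x : EuclideanSpace ℝ (Fin 3), v ‖x‖) ≠ ⊤ → ∀ (N : ℕ) (L : ℝ), 0 < L → ∀ q : EuclideanSpace ℝ (Fin 3), q ≠ 0 → Literature.MathematicalPhysics.QuantumManyBody.BoseGas.periodicGroundStateEnergy v N L < ⨅ (Ψ : Literature.MathematicalPhysics.QuantumManyBody.BoseGas.PeriodicTrialState N L) (_ : ∀ (s : EuclideanSpace ℝ (Fin 3)) (X : Fin N → EuclideanSpace ℝ (Fin 3)), Ψ.ψ (fun i => X i + s) = Complex.exp (Complex.I * ↑(∑ j, q j * s j)) * Ψ.ψ X), Literature.MathematicalPhysics.QuantumManyBody.BoseGas.periodicEnergy v Ψ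

/-- item stmt-AtomisticToContinuum-5152 · support · rank 9 · closed · moot by None · by planner
sources: Stringari1995, Wagner1966, PitaevskiiStringari1991, CorneanDerezinskiZin2009
[support] the card's theorem-shaped half (N2+N3), integrable v ≢ 0: ZeroMomentumGround-body(v) →
SectorGapFloor-body(v) → PeriodicBEC-body(v). Proof (operator-free, C¹-form level, δ chosen after
N): decompose a δ-near-minimiser Ψ into global-translation sectors Ψ = ΣΨ_q (C¹, Q-orthogonal); ZMG
+ H ≥ P²/N kill Σ_{q≠0}‖Ψ_q‖² ≤ δ/g_N; for Φ = Ψ₀/‖Ψ₀‖ use first-quantised a(φ_k), a†(φ_k) (as in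
`occupation`), the sector bounds Q_{N−1}(aΦ) ≥ E_{N−1}(k)n_k, Q_{N+1}(a†Φ) ≥ E_{N+1}(k)(n_k+1), the
identity Q_{N−1}(aΦ)+Q_{N+1}(a†Φ) = ⟨[[a,H],a†]⟩_Φ + Re(Q_N−E₀)((2n̂_k+1)Φ,Φ) with the error ≤
C(N,L,k,v)√δ by form Cauchy–Schwarz, and ⟨[[a_k,H],a_k†]⟩ ≤ k² + 2ρ‖v‖₁; hence n_k ≤
(k²+3ρ‖v‖₁)/(2κk²) on the window C = 4‖v‖₁; Parseval Σ_k n_k = N, Σ_k k²n_k = T ≤ E₀+δ ≤ ½ρ‖v‖₁N+δ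
(constant trial state) gives the UV tail ≤ N/8, and the d = 3 lattice count gives the IR sum ≤ C_v N
ρ^{1/2}/κ; so n₀ ≥ N/2 for ρ < ρ₀(v,κ), c = 1/2. [difficulty: XL] -/
@[route_item "route-AtomisticToContinuum-BECFeynmanWaist"]
def MomentBoundCondensation : Prop :=
  ∀ v : ℝ → ENNReal, Literature.MathematicalPhysics.QuantumManyBody.BoseGas.IsRepulsiveFiniteRange v → (∫⁻ x : EuclideanSpace ℝ (Fin 3), v ‖x‖) ≠ ⊤ → (∫⁻ x : EuclideanSpace ℝ (Fin 3), v ‖x‖) ≠ 0 → (∀ (N : ℕ) (L : ℝ), 0 < L → ∀ q : EuclideanSpace ℝ (Fin 3), q ≠ 0 → Literature.MathematicalPhysics.QuantumManyBody.BoseGas.periodicGroundStateEnergy v N L < ⨅ (Ψ : Literature.MathematicalPhysics.QuantumManyBody.BoseGas.PeriodicTrialState N L) (_ : ∀ (s : EuclideanSpace ℝ (Fin 3)) (X : Fin N → EuclideanSpace ℝ (Fin 3)), Ψ.ψ (fun i => X i + s) = Complex.exp (Complex.I * ↑(∑ j, q j * s j)) * Ψ.ψ X), Literature.MathematicalPhysics.QuantumManyBody.BoseGas.periodicEnergy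 v Ψ) → (∀ C : ℝ, 0 < C → ∃ κ : ℝ, 0 < κ ∧ ∃ ρ₀ : ℝ, 0 < ρ₀ ∧ ∀ ρ : ℝ, 0 < ρ → ρ < ρ₀ → ∀ᶠ N : ℕ in Filter.atTop, ∀ k : EuclideanSpace ℝ (Fin 3), k ≠ 0 → ‖k‖ ^ 2 ≤ C * ρ → 2 * Literature.MathematicalPhysics.QuantumManyBody.BoseGas.periodicGroundStateEnergy v N (Literature.MathematicalPhysics.QuantumManyBody.BoseGas.sideLength ρ N) + ENNReal.ofReal (2 * κ * ‖k‖ ^ 2) ≤ (⨅ (Ψ : Literature.MathematicalPhysics.QuantumManyBody.BoseGas.PeriodicTrialState (N + 1) (Literature.MathematicalPhysics.QuantumManyBody.BoseGas.sideLength ρ N)) (_ : ∀ (s : EuclideanSpace ℝ (Fin 3)) (X : Fin (N + 1) → EuclideanSpace ℝ (Fin 3)), Ψ.ψ (fun i => X i + s) = Complex.exp (Complex.I * ↑(∑ j, k j * s j)) * Ψ.ψ X), Literature.MathematicalPhysics.QuantumManyBody.BoseGas.periodicEnergy v Ψ) + (⨅ (Ψ : Literature.MathematicalPhysics.QuantumManyBody.BoseGas.PeriodicTrialState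 (N - 1) (Literature.MathematicalPhysics.QuantumManyBody.BoseGas.sideLength ρ N)) (_ : ∀ (s : EuclideanSpace ℝ (Fin 3)) (X : Fin (N - 1) → EuclideanSpace ℝ (Fin 3)), Ψ.ψ (fun i => X i + s) = Complex.exp (Complex.I * ↑(∑ j, k j * s j)) * Ψ.ψ X), Literature.MathematicalPhysics.QuantumManyBody.BoseGas.periodicEnergy v Ψ)) → ∃ ρ₀ : ℝ, 0 < ρ₀ ∧ ∀ ρ : ℝ, 0 < ρ → ρ < ρ₀ → ∃ c : ℝ, 0 < c ∧ ∀ᶠ N : ℕ in Filter.atTop, ∃ δ : ENNReal, 0 < δ ∧ ∀ Ψ : Literature.MathematicalPhysics.QuantumManyBody.BoseGas.PeriodicTrialState N (Literature.MathematicalPhysics.QuantumManyBody.BoseGas.sideLength ρ N), Literature.MathematicalPhysics.QuantumManyBody.BoseGas.periodicEnergy v Ψ ≤ Literature.MathematicalPhysics.QuantumManyBody.BoseGas.periodicGroundStateEnergy v N (Literature.MathematicalPhysics.QuantumManyBody.BoseGas.sideLength ρ N) + δ → ENNReal.ofReal (c * N) ≤ Literature.MathematicalPhysics.QuantumManyBody.BoseGas.condensateOccupation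 N (Literature.MathematicalPhysics.QuantumManyBody.BoseGas.sideLength ρ N) Ψ.ψ

/-- item stmt-AtomisticToContinuum-5153 · support · rank 9 · closed · moot by None · by planner
sources: LSSY2005
[support] the a.e.-free gas (∫v(|x|)dx = 0, where SectorGapFloor is false and not assumed) condenses
on the torus: periodicEnergy = kinetic energy, E₀^per = 0, and for a δ-near-minimiser Σ_{k≠0} n_k ≤
T(L/2π)² ≤ δL²/4π², so δ = 2π²/L² gives n₀ ≥ N − ½ (Parseval in one variable + Bessel for the
gradient). [difficulty: M] -/
@[route_item "route-AtomisticToContinuum-BECFeynmanWaist"]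
def FreeGasCondensation : Prop :=
  ∀ v : ℝ → ENNReal, Literature.MathematicalPhysics.QuantumManyBody.BoseGas.IsRepulsiveFiniteRange v → (∫⁻ x : EuclideanSpace ℝ (Fin 3), v ‖x‖) = 0 → ∃ ρ₀ : ℝ, 0 < ρ₀ ∧ ∀ ρ : ℝ, 0 < ρ → ρ < ρ₀ → ∃ c : ℝ, 0 < c ∧ ∀ᶠ N : ℕ in Filter.atTop, ∃ δ : ENNReal, 0 < δ ∧ ∀ Ψ : Literature.MathematicalPhysics.QuantumManyBody.BoseGas.PeriodicTrialState N (Literature.MathematicalPhysics.QuantumManyBody.BoseGas.sideLength ρ N), Literature.MathematicalPhysics.QuantumManyBody.BoseGas.periodicEnergy v Ψ ≤ Literature.MathematicalPhysics.QuantumManyBody.BoseGas.periodicGroundStateEnergy v N (Literature.MathematicalPhysics.QuantumManyBody.BoseGas.sideLength ρ N) + δ → ENNReal.ofReal (c * N) ≤ Literature.MathematicalPhysics.QuantumManyBody.BoseGas.condensateOccupation N (Literature.MathematicalPhysics.QuantumManyBody.BoseGas.sideLength ρ N) Ψ.ψ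

/-- item stmt-AtomisticToContinuum-8141 · support · rank 9 · closed · moot by None · by planner
sources: Feynman1954, arXiv:0910.2805, doi:10.1103/PhysRevA.7.2187
[support] (card (T), Feynman's 1954 symmetry argument made topological; provable now, of independent
interest) for N bosons on the torus of side L > 0 and m ∈ ℤ³ with NOT (N ∣ m_t for all t), every
continuous F : (ℝ³)^N → ℂ that is Lℤ³-periodic in each particle, permutation-symmetric and
Bloch-equivariant F(X + s·𝟙) = e^(i(2π/L)m·s)F(X) has a zero. Proof: if F ≠ 0 everywhere, the
winding number w of F along "particle j once around direction t" is independent of j (symmetry) and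
of the base point (homotopy), and the diagonal loop X ↦ X + uLe_t𝟙 is homotopic in (ℝ³/Lℤ³)^N to the
concatenation of the N single-particle loops, so its degree m_t equals N·w. Sharp: for N ∣ m the
boost e^(i(k/N)·Σx_j) is nodeless (Bloch 1973; Kanamoto–Carr–Ueda). Role: not in the assembly chain;
it gives J_F ≢ 0 for every C¹ admissible F in the window (J ≡ 0 means rank ≤ 1, so the image is
Lebesgue-null; but by equivariance it is rotation-invariant, connected, and contains 0 and a point
of modulus ≥ 1, hence the closed unit disc — contradiction) — the qualitative, per-map form of
VortexAreaFloor — and it is the topological obstruction that makes exact calibrations of the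
diagonal momentum impossible, i.e. -/
@[route_item "route-AtomisticToContinuum-BECFeynmanWaist"]
def NodalLemma : Prop :=
  ∀ (N : ℕ) (L : ℝ), 0 < L → ∀ m : Fin 3 → ℤ, (¬ ∀ t : Fin 3, (N : ℤ) ∣ m t) → ∀ F : (Fin N → EuclideanSpace ℝ (Fin 3)) → ℂ, Continuous F → (∀ (X : Fin N → EuclideanSpace ℝ (Fin 3)) (i : Fin N) (t : Fin 3), F (X + Pi.single i (EuclideanSpace.single t L)) = F X) → (∀ (σ : Equiv.Perm (Fin N)) (X : Fin N → EuclideanSpace ℝ (Fin 3)), F (X ∘ σ) = F X) → (∀ (s : EuclideanSpace ℝ (Fin 3)) (X : Fin N → EuclideanSpace ℝ (Fin 3)), F (fun i => X i + s) = Complex.exp (Complex.I * ↑(∑ t, 2 * Real.pi / L * (m t : ℝ) * s t)) * F X) → ∃ X, F X = 0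

/-- item stmt-AtomisticToContinuum-8142 · support · rank 9 · closed · moot by None · by planner
sources: ReedSimonIV1978, GilbargTrudinger2001, CorneanDerezinskiZin2009
[support] (construction statement for the posited interface; known mathematics, heavy in Lean) for
bounded repulsive finite-range v, every N and every L > 0 there is a periodic C¹ trial state Φ of N
bosons on the torus of side L attaining E₀^per(N,L) < ∞, with Φ real and strictly positive
everywhere and invariant under diagonal translations X ↦ X + s𝟙. Proof: v^per is bounded (finitely
many images), H = −Δ + V^per on (ℝ³/Lℤ³)^N has compact resolvent and positivity-improving heat
semigroup, so the ground state is unique, strictly positive (Harnack), hence permutation-symmetric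
and translation-invariant; W^(2,p) regularity for all p < ∞ gives Φ ∈ C^(1,α), so Φ lies in the C¹
class and its energy is the infimum over the C¹ form core. Existence is deliberately NOT smuggled
into the interface hypotheses of VortexAreaFloor/GroundStateRepresentation. [difficulty: XL] -/
@[route_item "route-AtomisticToContinuum-BECFeynmanWaist"]
def TorusGroundState : Prop :=
  ∀ v : ℝ → ENNReal, Literature.MathematicalPhysics.QuantumManyBody.BoseGas.IsRepulsiveFiniteRange v → (∃ M : NNReal, ∀ r, v r ≤ M) → ∀ (N : ℕ) (L : ℝ), 0 < L → ∃ Φ : Literature.MathematicalPhysics.QuantumManyBody.BoseGas.PeriodicTrialState N L, Literature.MathematicalPhysics.QuantumManyBody.BoseGas.periodicEnergy v Φ = Literature.MathematicalPhysics.QuantumManyBody.BoseGas.periodicGroundStateEnergy v N L ∧ Literature.MathematicalPhysics.QuantumManyBody.BoseGas.periodicGroundStateEnergy v N L ≠ ⊤ ∧ (∀ X, 0 < (Φ.ψ X).re ∧ (Φ.ψ X).im = 0) ∧ (∀ (s : EuclideanSpace ℝ (Fin 3)) (X : Fin N → EuclideanSpace ℝ (Fin 3)), Φ.ψ (fun i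 => X i + s) = Φ.ψ X)

/-- item stmt-AtomisticToContinuum-8143 · support · rank 9 · closed · moot by None · by planner
sources: ReedSimonIV1978, CorneanDerezinskiZin2009, Feynman1954
[support] (ground-state transform identity; provable now) for bounded repulsive finite-range v, any
periodic C¹ trial state Φ attaining E₀^per(N,L) < ∞ with Φ real positive, and any C¹ map F that is
Lℤ³-periodic in each particle and permutation-symmetric: ∫_cell (|∇(FΦ)|² + V^per|FΦ|²) =
E₀^per(N,L)·∫_cell |F|²Φ² + ∫_cell |∇F|²Φ² (all terms in ℝ≥0∞, no subtraction). Proof: expand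
|∇(FΦ)|² = |∇F|²Φ² + ∇|F|²·Φ∇Φ + |F|²|∇Φ|² and use the weak Euler–Lagrange equation of the minimiser
Φ within the C¹ symmetric periodic class tested against η = |F|²Φ. Shared object with card
sector-poincare-two-scale's (SP_k). [difficulty: L] -/
@[route_item "route-AtomisticToContinuum-BECFeynmanWaist"]
def GroundStateRepresentation : Prop :=
  ∀ v : ℝ → ENNReal, Literature.MathematicalPhysics.QuantumManyBody.BoseGas.IsRepulsiveFiniteRange v → (∃ M : NNReal, ∀ r, v r ≤ M) → ∀ (N : ℕ) (L : ℝ) (Φ : Literature.MathematicalPhysics.QuantumManyBody.BoseGas.PeriodicTrialState N L), Literature.MathematicalPhysics.QuantumManyBody.BoseGas.periodicEnergy v Φ = Literature.MathematicalPhysics.QuantumManyBody.BoseGas.periodicGroundStateEnergy v N L → Literature.MathematicalPhysics.QuantumManyBody.BoseGas.periodicGroundStateEnergy v N L ≠ ⊤ → (∀ X, 0 < (Φ.ψ X).re ∧ (Φ.ψ X).im = 0) → ∀ F : (Fin N → EuclideanSpace ℝ (Fin 3)) → ℂ, ContDiff ℝ 1 F → (∀ (X : Fin N → EuclideanSpace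 ℝ (Fin 3)) (i : Fin N) (t : Fin 3), F (X + Pi.single i (EuclideanSpace.single t L)) = F X) → (∀ (σ : Equiv.Perm (Fin N)) (X : Fin N → EuclideanSpace ℝ (Fin 3)), F (X ∘ σ) = F X) → ∫⁻ X in Literature.MathematicalPhysics.QuantumManyBody.BoseGas.cellN N L, Literature.MathematicalPhysics.QuantumManyBody.BoseGas.kineticDensity (fun Y => F Y * Φ.ψ Y) X + Literature.MathematicalPhysics.QuantumManyBody.BoseGas.periodicInteraction v L X * (‖F X * Φ.ψ X‖₊ : ENNReal) ^ 2 = Literature.MathematicalPhysics.QuantumManyBody.BoseGas.periodicGroundStateEnergy v N L * (∫⁻ X in Literature.MathematicalPhysics.QuantumManyBody.BoseGas.cellN N L, (‖F X‖₊ : ENNReal) ^ 2 * (‖Φ.ψ X‖₊ : ENNReal) ^ 2) + ∫⁻ X in Literature.MathematicalPhysics.QuantumManyBody.BoseGas.cellN N L, Literature.MathematicalPhysics.QuantumManyBody.BoseGas.kineticDensity F X * (‖Φ.ψ X‖₊ : ENNReal) ^ 2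

/-- item stmt-AtomisticToContinuum-8144 · support · rank 9 · closed · moot by None · by planner
sources: Feynman1954, Stringari1995, Wagner1966, CorneanDerezinskiZin2009
[support] (glue, provable now) VortexAreaFloor → TorusGroundState → GroundStateRepresentation →
NearConvexity → ZeroMomentumGround → MomentBoundCondensation → FreeGasCondensation → for every
bounded repulsive finite-range v, the PeriodicBEC body for v. Proof: if ∫v = 0 use
FreeGasCondensation. Else fix C > 0; VortexAreaFloor with Λ = 1 gives c, put κ₁ = min(1, 2c), κ =
κ₁/2; for a Bloch-k periodic trial state Ψ of N ± 1 particles at L = (N/ρ)^(1/3) put F = Ψ/Φ (Φ from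
TorusGroundState; F is C¹, periodic, symmetric, Bloch-k because Φ is translation-invariant, ∫|F|²Φ²
= 1): periodicEnergy Ψ = E₀ + ∫|∇F|²Φ² (GroundStateRepresentation) and pointwise |∇F|² ≥ 2J_F (Gram
determinant ≤ product of the diagonal entries, AM–GM), so either ∫|∇F|²Φ² ≥ |k|² or ∫|∇F|²Φ² ≥
2∫J_FΦ² ≥ 2c|k|²; hence E_(N±1)(k) ≥ E₀(N±1) + κ₁|k|²; a non-empty Bloch class forces k ∈ (2π/L)ℤ³,
so |k| ≥ 2π/L, and NearConvexity at tolerance κ₁ yields 2E₀(N) + 2κ|k|² ≤ E_(N+1)(k) + E_(N−1)(k),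
the SectorGapFloor body for v; boundedness + finite range give ∫v < ∞, ZeroMomentumGround gives the
zero-momentum gap and MomentBoundCondensation concludes. [difficulty: L] -/
@[route_item "route-AtomisticToContinuum-BECFeynmanWaist"]
def VortexAreaToPeriodicBEC : Prop :=
  VortexAreaFloor → TorusGroundState → GroundStateRepresentation → NearConvexity → ZeroMomentumGround → MomentBoundCondensation → FreeGasCondensation → ∀ v : ℝ → ENNReal, Literature.MathematicalPhysics.QuantumManyBody.BoseGas.IsRepulsiveFiniteRange v → (∃ M : NNReal, ∀ r, v r ≤ M) → ∃ ρ₀ : ℝ, 0 < ρ₀ ∧ ∀ ρ : ℝ, 0 < ρ → ρ < ρ₀ → ∃ c : ℝ, 0 < c ∧ ∀ᶠ N : ℕ in Filter.atTop, ∃ δ : ENNReal, 0 < δ ∧ ∀ Ψ : Literature.MathematicalPhysics.QuantumManyBody.BoseGas.PeriodicTrialState N (Literature.MathematicalPhysics.QuantumManyBody.BoseGas.sideLength ρ N), Literature.MathematicalPhysics.QuantumManyBody.BoseGas.periodicEnergy v Ψ ≤ Literature.MathematicalPhysics.QuantumManyBody.BoseGas.periodicGroundStateEnergy v N (Literature.MathematicalPhysics.QuantumManyBody.BoseGas.sideLength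 ρ N) + δ → ENNReal.ofReal (c * N) ≤ Literature.MathematicalPhysics.QuantumManyBody.BoseGas.condensateOccupation N (Literature.MathematicalPhysics.QuantumManyBody.BoseGas.sideLength ρ N) Ψ.ψ

/-- item stmt-AtomisticToContinuum-8145 · assembly · rank 1 · closed · moot by None · by planner
sources: LSSY2005, Feynman1954, CorneanDerezinskiZin2009, Stringari1995
[assembly] VortexAreaFloor → TorusGroundState → GroundStateRepresentation → NearConvexity →
ZeroMomentumGround → MomentBoundCondensation → FreeGasCondensation → VortexAreaToPeriodicBEC →
BoundaryTransferWeak → ScatteringLengthTransfer → RepresentativesExist → ScatteringLengthFinite →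
BoseEinsteinCondensation. -/
@[route_item "route-AtomisticToContinuum-BECFeynmanWaist"]
def Assembly : Prop :=
  VortexAreaFloor → TorusGroundState → GroundStateRepresentation → NearConvexity → ZeroMomentumGround → MomentBoundCondensation → FreeGasCondensation → VortexAreaToPeriodicBEC → BoundaryTransferWeak → ScatteringLengthTransfer → RepresentativesExist → ScatteringLengthFinite → Literature.MathematicalPhysics.QuantumManyBody.BoseGas.BoseEinsteinCondensation

end Summit.AtomisticToContinuum.BoseEinsteinCondensation.Theses.BECFeynmanWaist
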